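import Mathlib
import Summits.PneNP.PneNP.Theses.OneSlice
import Summits.PneNP.PneNP.Theorems.OneSliceSliceTargetSplit
import Summits.PneNP.PneNP.Theorems.OneSliceMonotoneContinuationDefs
import Summits.PneNP.PneNP.Theorems.OneSliceMonotoneContinuationTransportMono
import Summits.PneNP.PneNP.Theorems.OneSliceMonotoneContinuationLevelAverage
import Summits.PneNP.PneNP.Theorems.OneSliceMonotoneContinuationSamplerExpansion
import Summits.PneNP.PneNP.Theorems.OneSliceMonotoneContinuationBinomialMixing
import Summits.PneNP.PneNP.Theorems.OneSliceMonotoneContinuationCore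
import Summits.PneNP.PneNP.Theorems.OneSliceShallowSliceBoundNotSharp

/-!
# Route OneSlice, crux `MonotoneContinuation` (stmt-PneNP-18471), line `Sketch_ideator1_r1` (ProfileLine) — partial results: the crux on the one-sided-flat and monotone-AC⁰ classes

`monotoneContinuation_flat`: the conclusion of `OneSlice.MonotoneContinuation` (c' = c+4) for every small monotone circuit whose own
profile is one-sided flat near the central slice (not CLT-sharp on one side). `monotoneContinuation_shallow`: the same for every small
monotone circuit whose function also has a bounded-depth polynomial-size unbounded-fan-in circuit (the whole monotone-AC⁰ class), via
the landed `ShallowSliceBound.shallow_not_sharp` (Boppana/Tal). Both unconditional.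

Lead prover-line-stmt-PneNP-18471-0, 2026-08-17. Def-free (vocabulary in `OneSliceMonotoneContinuationDefs.lean`).
-/

set_option linter.dupNamespace false -- `Summit.PneNP.PneNP.…`: summit = sub-problem (D-0017)

namespace Summit.PneNP.PneNP.Theorems.MonotoneContinuation

open Literature.Computability.Complexity hiding supp mem_supp
open Finset hiding slice
open Filter hiding mem_sdiff
open Classical
open Summit.PneNP.PneNP.Theorems (binomialWeight_tail_le binomialWeight_sum_range binomialWeight_nonneg card_slice
  tendsto_mean eventually_window central_add_le mean_ge)
open Summit.PneNP.PneNP.Theorems.ConstantBand.Negative (Edge thr Central slice)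
open Summit.PneNP.PneNP.Theorems.SingleThreshold.Negative (pc tendsto_pc pc_nonneg)
open Summit.PneNP.PneNP.Theorems.SliceTargetSplit (Comp nbhd mem_nbhd transport ind l1 nbhdCard ind_nonneg ind_le_one
  abs_ind_sub_ind l1_comm l1_nonneg l1_triangle l1_eq_sum_slices card_nbhd card_nbhd_of_le card_nbhd_of_ge
  choose_mul_nbhdCard nbhdCard_pos sum_slice_sum_nbhd sum_slice_sum_nbhd_left transport_nonneg transport_sub
  l1_transport_le rdist_eq_l1 transport_ind_mem)

noncomputable section

variable {n : ℕ}

/-! ## Partial result: the crux holds on the ONE-SIDED-FLAT class (unconditional) -/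

/-- The crux restricted to circuits whose OWN profile is already one-sided flat near `j` (tolerance `η/100`, width
`2(⌈500/η⌉₊+1)·⌊√j⌋`): there the residual is witnessed by `C₁ := C`, so the continuation is a theorem, with `c' = c + 4`. This covers every `C` that is not CLT-sharp at `j` on at least one side (e.g. all transport-stable
`C`, all `C` whose acceptance probability does not jump across the `√m`-window). [folklore] -/
theorem monotoneContinuation_flat :
    ∀ c k : ℕ, 3 ≤ k → ∀ η : ℝ, 0 < η → ∃ ε : ℝ, 0 < ε ∧ ∀ᶠ n : ℕ in atTop, ∀ j : ℕ, Central k n j →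
      ∀ C : Circuit (Edge n), C.IsOver monotoneBasis → C.size ≤ n ^ c →
        ((∀ r : ℕ, r ≤ 2 * (⌈5 / (η / 100)⌉₊ + 1) * Nat.sqrt j → profile C.eval (j + r) - profile C.eval j ≤ η / 100) ∨
         (∀ r : ℕ, r ≤ 2 * (⌈5 / (η / 100)⌉₊ + 1) * Nat.sqrt j → profile C.eval j - profile C.eval (j - r) ≤ η / 100)) →
        (∃ F : (Edge n → Bool) → Bool, Monotone F ∧ l1 n (pc n k) (ind F) (transport j (ind C.eval)) ≤ ε) →
        ∃ C' : Circuit (Edge n), C'.IsOver monotoneBasis ∧ C'.size ≤ n ^ (c + 4) ∧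
          l1 n (pc n k) (ind C'.eval) (transport j (ind C.eval)) ≤ η := by
  intro c k hk η hη
  refine mc_core hk hη
    (fun n j C => (∀ r : ℕ, r ≤ 2 * (⌈5 / (η / 100)⌉₊ + 1) * Nat.sqrt j →
        profile C.eval (j + r) - profile C.eval j ≤ η / 100) ∨
      (∀ r : ℕ, r ≤ 2 * (⌈5 / (η / 100)⌉₊ + 1) * Nat.sqrt j →
        profile C.eval j - profile C.eval (j - r) ≤ η / 100))
    ⟨1, one_pos, Filter.Eventually.of_forall fun n j _ C hC hsize hP _ => ⟨C, hC, hsize, ?_, hP⟩⟩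
  have h0 : (∑ x ∈ slice n j, |ind C.eval x - ind C.eval x|) = 0 := by simp
  rw [h0]
  positivity

/-! ## Partial result: the crux holds on the MONOTONE-AC⁰ class (unconditional) -/

section Shallow

open Summit.PneNP.PneNP.Cruxes.SliceACZero.RussoWindowLadder (wt sliceAvg)
open Summit.PneNP.PneNP.Theorems.ShallowSliceBound (shallow_not_sharp)

/-- The profile is the slice average of the `ShallowSliceBound` lane. -/
theorem profile_eq_sliceAvg (f : (Edge n → Bool) → Bool) (ℓ : ℕ) : profile f ℓ = sliceAvg f ℓ := by
  unfold profile sliceAvg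
  have hslice : slice n ℓ = univ.filter fun x : Edge n → Bool => wt x = ℓ := rfl
  have hnum : ∑ x ∈ slice n ℓ, ind f x = #(univ.filter fun x : Edge n → Bool => wt x = ℓ ∧ f x = true) := by
    rw [hslice]
    unfold ind
    rw [Finset.sum_boole, Finset.filter_filter]
  rw [hnum, hslice]

/-- `A⁴/2 − A³ + 4 ≥ 0` for `A ≥ 0` (minimum `−27/32 + 4` at `A = 3/2`). -/
theorem quartic_aux {A : ℝ} (hA : 0 ≤ A) : A ^ 4 / 2 - 4 ≤ A ^ 4 - A ^ 3 := by
  nlinarith [sq_nonneg (A - 3 / 2), sq_nonneg (A ^ 2 - 3 / 2 * A), mul_nonneg hA (sq_nonneg (A - 3 / 2))]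

/-- Eventually `16 j ≤ N` and `n ≤ 5 j` for central `j` (since `p_c → 0` and `μ ≥ (n-1)/2`). -/
theorem eventually_shallow_facts {k : ℕ} (hk : 3 ≤ k) :
    ∀ᶠ n : ℕ in atTop, ∀ j : ℕ, Central k n j → 16 * j ≤ n.choose 2 ∧ n ≤ 5 * j := by
  have hp := (tendsto_pc (show 2 ≤ k by omega)).eventually (eventually_le_nhds (show (0 : ℝ) < 1 / 32 by norm_num))
  filter_upwards [eventually_window hk 0, hp, eventually_ge_atTop 95] with n hwin hp32 hn95 j hj
  obtain ⟨hp0, -, h34, -, -⟩ := hwin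
  have hn1 : 1 ≤ n := by omega
  have hjc := abs_le.1 hj
  have hμ0 : 0 ≤ ((n.choose 2 : ℕ) : ℝ) * pc n k := mul_nonneg (Nat.cast_nonneg _) hp0.le
  have hmμ : (thr k n : ℝ) ≤ ((n.choose 2 : ℕ) : ℝ) * pc n k := Nat.floor_le hμ0
  have hμm : ((n.choose 2 : ℕ) : ℝ) * pc n k < (thr k n : ℝ) + 1 := Nat.lt_floor_add_one _
  have hmean := mean_ge hk hn1
  have hm0 : (0 : ℝ) ≤ thr k n := Nat.cast_nonneg _
  set A : ℝ := (thr k n : ℝ) ^ ((1 : ℝ) / 4) with hAdef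
  have hmA : (thr k n : ℝ) = A ^ 4 := by
    rw [hAdef, ← Real.rpow_natCast, ← Real.rpow_mul hm0]; norm_num
  have hRA : (thr k n : ℝ) ^ ((3 : ℝ) / 4) = A ^ 3 := by
    rw [hAdef, ← Real.rpow_natCast, ← Real.rpow_mul hm0]; norm_num
  have hA0 : 0 ≤ A := Real.rpow_nonneg hm0 _
  -- `R ≤ m` (as `A³ ≤ A⁴`, using `A ≥ 1` from `2 ≤ R = A³`)
  have hA1 : 1 ≤ A := by
    by_contra h
    push Not at h
    have : A ^ 3 ≤ 1 := pow_le_one₀ hA0 h.le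
    rw [← hRA] at this
    linarith
  have hRm : (thr k n : ℝ) ^ ((3 : ℝ) / 4) ≤ thr k n := by
    rw [hRA, hmA]; nlinarith [pow_nonneg hA0 3]
  have hN0 : (0 : ℝ) ≤ (n.choose 2 : ℕ) := Nat.cast_nonneg _
  constructor
  · have h1 : (16 * j : ℝ) ≤ (n.choose 2 : ℕ) := by nlinarith [hjc.2]
    exact_mod_cast h1
  · -- `j ≥ m - R = A⁴ - A³ ≥ m/2 - 4 ≥ (μ - 1)/2 - 4 ≥ (n - 19)/4 ≥ n/5` for `n ≥ 95`
    have hkey := quartic_aux hA0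
    have h2 : (thr k n : ℝ) / 2 - 4 ≤ j := by
      have h1 : (thr k n : ℝ) - (thr k n : ℝ) ^ ((3 : ℝ) / 4) ≤ j := by linarith [hjc.1]
      rw [hRA] at h1
      rw [hmA] at h1 ⊢
      linarith
    have hn95r : (95 : ℝ) ≤ n := by exact_mod_cast hn95
    have h3 : (n : ℝ) ≤ 5 * j := by linarith
    exact_mod_cast h3

/-- **The crux on the monotone-AC⁰ class.** For every depth `d` and exponent `c`: the conclusion of
`OneSlice.MonotoneContinuation` (with `c' = c + 4`) holds for every `{∧₂,∨₂}`-circuit `C` of size `≤ n^c` whose function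
is also computed by an unbounded-fan-in `{¬,∧,∨}`-circuit of `acDepth ≤ d` and `≤ n^c` gates — its profile is flat above
every central slice across `j^{2/3} ≫ √j` slices by `shallow_not_sharp` (Boppana / Tal, landed for `ShallowSliceBound`),
so `monotoneContinuation_flat` applies. Unconditional. [folklore] -/
theorem monotoneContinuation_shallow :
    ∀ d c k : ℕ, 3 ≤ k → ∀ η : ℝ, 0 < η → ∃ ε : ℝ, 0 < ε ∧ ∀ᶠ n : ℕ in atTop, ∀ j : ℕ, Central k n j →
      ∀ C : Circuit (Edge n), C.IsOver monotoneBasis → C.size ≤ n ^ c →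
        (∃ D : Circuit (Edge n), D.IsOver acBasis ∧ D.acDepth ≤ d ∧ D.size ≤ n ^ c ∧ D.eval = C.eval) →
        (∃ F : (Edge n → Bool) → Bool, Monotone F ∧ l1 n (pc n k) (ind F) (transport j (ind C.eval)) ≤ ε) →
        ∃ C' : Circuit (Edge n), C'.IsOver monotoneBasis ∧ C'.size ≤ n ^ (c + 4) ∧
          l1 n (pc n k) (ind C'.eval) (transport j (ind C.eval)) ≤ η := by
  intro d c k hk η hη
  obtain ⟨ε, hε, hev⟩ := monotoneContinuation_flat c k hk η hη
  -- flatness of shallow circuits, with exponent `c + 1` in `j` and window exponent `θ = 1/3`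
  obtain ⟨j₀, hj₀⟩ := shallow_not_sharp d (c + 1) (1 / 3) (by norm_num) (η / 100) (by positivity)
  obtain ⟨L, hLdef⟩ : ∃ L : ℕ, L = ⌈5 / (η / 100)⌉₊ + 1 := ⟨_, rfl⟩
  obtain ⟨M, hMdef⟩ : ∃ M : ℕ, M = max j₀ (max (5 ^ c) ((2 * L) ^ 6)) := ⟨_, rfl⟩
  refine ⟨ε, hε, ?_⟩
  filter_upwards [hev, eventually_central hk M, eventually_shallow_facts hk] with n hn hcen hsh j hj C hC hsize hD' hF'
  obtain ⟨-, -, hcenj⟩ := hcen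
  obtain ⟨hjN, hjL, -⟩ := hcenj j hj
  obtain ⟨hN16, hn5j⟩ := hsh j hj
  obtain ⟨D, hDB, hDd, hDsize, hDeval⟩ := hD'
  refine hn j hj C hC hsize (Or.inl fun r hr => ?_) hF'
  rw [← hLdef] at hr
  -- bounds on `j`
  have hMj : M ≤ j := (Nat.le_self_pow two_ne_zero M).trans (by omega)
  have hjj₀ : j₀ ≤ j := by rw [hMdef] at hMj; exact (le_max_left _ _).trans hMj
  have hj5c : 5 ^ c ≤ j := by rw [hMdef] at hMj; exact ((le_max_left _ _).trans (le_max_right _ _)).trans hMj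
  have hjL6 : (2 * L) ^ 6 ≤ j := by rw [hMdef] at hMj; exact ((le_max_right _ _).trans (le_max_right _ _)).trans hMj
  have hj1 : 1 ≤ j := le_trans (Nat.one_le_pow _ _ (by norm_num)) hj5c
  have hj0 : (0 : ℝ) ≤ j := Nat.cast_nonneg _
  have hj1r : (1 : ℝ) ≤ j := by exact_mod_cast hj1
  -- `r ≤ 2L⌊√j⌋ ≤ j^{1/6} j^{1/2} = j^{2/3}`
  have hr23 : (r : ℝ) ≤ (j : ℝ) ^ (1 - (1 / 3 : ℝ)) := by
    have hr' : (r : ℝ) ≤ 2 * L * Nat.sqrt j := by exact_mod_cast hr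
    refine hr'.trans ?_
    have hsq : ((Nat.sqrt j : ℕ) : ℝ) ≤ (j : ℝ) ^ ((1 : ℝ) / 2) := by
      rw [← Real.sqrt_eq_rpow, Real.le_sqrt (Nat.cast_nonneg _) hj0]
      exact_mod_cast Nat.sqrt_le' j
    have h2L : (2 * L : ℝ) ≤ (j : ℝ) ^ ((1 : ℝ) / 6) := by
      have h6 : ((2 * L : ℕ) : ℝ) ^ (6 : ℕ) ≤ j := by exact_mod_cast hjL6
      have h2L0 : (0 : ℝ) ≤ (2 * L : ℕ) := Nat.cast_nonneg _
      have h7 := Real.rpow_le_rpow (by positivity) h6 (show (0 : ℝ) ≤ 1 / 6 by norm_num)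
      rw [← Real.rpow_natCast, ← Real.rpow_mul h2L0] at h7
      norm_num at h7
      exact_mod_cast h7
    calc (2 * L : ℝ) * (Nat.sqrt j : ℕ) ≤ (j : ℝ) ^ ((1 : ℝ) / 6) * (j : ℝ) ^ ((1 : ℝ) / 2) :=
          mul_le_mul h2L hsq (Nat.cast_nonneg _) (Real.rpow_nonneg hj0 _)
      _ = (j : ℝ) ^ (1 - (1 / 3 : ℝ)) := by rw [← Real.rpow_add' hj0 (by norm_num)]; norm_num
  have ht : ((j + r : ℕ) : ℝ) ≤ j + (j : ℝ) ^ (1 - (1 / 3 : ℝ)) := by push_cast; linarith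
  have hrj : r ≤ j := by
    have h1 : (j : ℝ) ^ (1 - (1 / 3 : ℝ)) ≤ j := by
      calc (j : ℝ) ^ (1 - (1 / 3 : ℝ)) ≤ (j : ℝ) ^ (1 : ℝ) := Real.rpow_le_rpow_of_exponent_le hj1r (by norm_num)
        _ = j := Real.rpow_one _
    have : (r : ℝ) ≤ j := hr23.trans h1
    exact_mod_cast this
  have h4t : 4 * (j + r) ≤ Fintype.card (Edge n) := by
    rw [card_edgeSet_top_fin]; omega
  -- `D.size ≤ n^c ≤ (5j)^c ≤ j^{c+1}`
  have hDsize' : D.size ≤ j ^ (c + 1) := by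
    calc D.size ≤ n ^ c := hDsize
      _ ≤ (5 * j) ^ c := Nat.pow_le_pow_left hn5j _
      _ = 5 ^ c * j ^ c := mul_pow 5 j c
      _ ≤ j * j ^ c := Nat.mul_le_mul_right _ hj5c
      _ = j ^ (c + 1) := by ring
  have hmonoD : Monotone D.eval := by rw [hDeval]; exact C.monotone_eval_of_isOver_monotoneBasis hC
  have key := hj₀ (Edge n) j (j + r) hjj₀ (Nat.le_add_right _ _) ht h4t D hDB hmonoD hDd hDsize'
  rw [← profile_eq_sliceAvg, ← profile_eq_sliceAvg, hDeval] at key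
  linarith

end Shallow

end

end Summit.PneNP.PneNP.Theorems.MonotoneContinuation
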